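import Literature.MathematicalPhysics.QuantumLattice.LiebWuFiniteBNeumannSeries
import HarnessLib

/-!
# The fixed-point equation of the Lieb–Wu Neumann series for a general rapidity range

Family `hubbard`. Continuation of `LiebWuFiniteBNeumannSeries` (Lieb–Wu, Physica A 321 (2003) 1, §5,
proof of Theorem 1, eqs. (S), (W), (series), for the rapidity range `S`, printed case `S = [-B, B]`):
the Neumann-series solution `σ_S = Σₙ Ŵⁿξ` satisfies **`σ_S = ξ + Ŵσ_S`** (`liebWuSigmaAtS_eq_xi_add_WS`).
The only work is passing the integral operator `Ŵ = R̂ÂK̂B̂ + R̂K̂(1 - B̂)` (bounded kernels) through the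
`L¹`-convergent sum, term by term (`liebWuWS_liebWuSigmaAtS`). No named fact.

## References

* E. H. Lieb, F. Y. Wu, Physica A 321 (2003) 1–27 = arXiv:cond-mat/0207529, §5, Theorem 1, eqs. (S),
  (W), (series) (key `LiebWuPhysicaA2003`); PRL 20 (1968) 1445, statement (a) (`LiebWuPRL1968`).
-/

noncomputable section

open MeasureTheory Set Real Filter intervalIntegral
open Literature.Analysis.SpecialFunctions
open scoped Convolution Topology

namespace Literature.MathematicalPhysics.QuantumLattice

namespace LiebWuNeumannSFix

variable {f g : ℝ → ℝ} {B : ℝ}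

/-- `t ↦ f(t) g(x - t)` is integrable for `f ∈ L¹`, `g` bounded continuous. [folklore] -/
private theorem integrable_mul_sub₂ (hf : Integrable f) (hgc : Continuous g) (hgB : ∀ y, |g y| ≤ B)
    (x : ℝ) : Integrable fun t => f t * g (x - t) :=
  hf.mul_bdd (hgc.comp (continuous_const.sub continuous_id)).aestronglyMeasurable
    (Eventually.of_forall fun t => by rw [Real.norm_eq_abs]; exact hgB _)

/-- `∫∫ f(t) g(x - t) dt dx = (∫ f)(∫ g)` for `f, g ∈ L¹`, and the convolution is integrable. [folklore] -/
private theorem integrable_conv_and_integral₂ (hf : Integrable f) (hg : Integrable g) :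
    Integrable (fun x => ∫ t, f t * g (x - t)) ∧
      ∫ x, ∫ t, f t * g (x - t) = (∫ t, f t) * ∫ y, g y := by
  have h : (fun x => ∫ t, f t * g (x - t)) = f ⋆[ContinuousLinearMap.mul ℝ ℝ, volume] g := by
    funext x; rw [convolution_def]; simp only [ContinuousLinearMap.mul_apply']
  rw [h]
  exact ⟨hf.integrable_convolution _ hg, by
    rw [integral_convolution (L := ContinuousLinearMap.mul ℝ ℝ) hf hg]; rfl⟩

end LiebWuNeumannSFix

open LiebWuNeumannSFix

variable {U Q : ℝ} {S : Set ℝ}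

/-! ### The fixed point -/

/-- `Ŵ` passes through the `L¹`-convergent sum of the Neumann terms: `Ŵ(Σₙ Ŵⁿξ) = Σₙ Ŵⁿ⁺¹ξ`.
[cite: LiebWuPhysicaA2003, §5, eqs. (S), (series)] -/
theorem liebWuWS_liebWuSigmaAtS (hU : 0 < U) (hQ : 0 < Q) (hS : MeasurableSet S) (x : ℝ) :
    liebWuWS U Q S (liebWuSigmaAtS U Q S) x = ∑' n, liebWuNeumannTermS U Q S (n + 1) x := by
  have hc : 0 < U / 4 := by positivity
  have hprops := liebWuNeumannTermS_props hU hQ hS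
  have hsumI := summable_integral_liebWuNeumannTermS hU hQ hS
  have hKB : ∀ z, |cauchyDensity (U / 4) z| ≤ 1 / (π * (U / 4)) := fun z => by
    rw [abs_of_pos (cauchyDensity_pos hc z)]; exact cauchyDensity_le hc z
  have huB : ∀ y, |fermiKernel (U / 4) y| ≤ 1 / (2 * π * (U / 4)) := fun y => by
    rw [abs_of_nonneg (fermiKernel_nonneg hc y)]; exact fermiKernel_le hc y
  set A : ℝ → ℝ := (Ioc (-Real.sin Q) (Real.sin Q)).indicator (fun _ => (1 : ℝ)) with hA
  have hA1 : ∀ y, |A y| ≤ 1 := fun y => by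
    by_cases hy : y ∈ Ioc (-Real.sin Q) (Real.sin Q)
    · simp [hA, indicator_of_mem hy]
    · simp [hA, indicator_of_notMem hy]
  have hAm : AEStronglyMeasurable A volume := aestronglyMeasurable_const.indicator measurableSet_Ioc
  -- the pieces `1_S Ŵⁿξ`, `1_{Sᶜ} Ŵⁿξ`
  set σ := liebWuSigmaAtS U Q S with hσdef
  set T : ℕ → ℝ → ℝ := liebWuNeumannTermS U Q S with hT
  have hTSi : ∀ n, Integrable (S.indicator (T n)) := fun n => (hprops n).2.2.1.indicator hS
  have hTSci : ∀ n, Integrable (Sᶜ.indicator (T n)) := fun n => (hprops n).2.2.1.indicator hS.compl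
  have hnormS : ∀ (R : Set ℝ) n t, ‖R.indicator (T n) t‖ ≤ ‖T n t‖ := fun R n t => by
    rw [Real.norm_eq_abs, Real.norm_eq_abs, abs_of_nonneg (indicator_nonneg (fun s _ => (hprops n).2.1 s) _),
      abs_of_nonneg ((hprops n).2.1 t)]
    exact indicator_le_self' (fun s _ => (hprops n).2.1 s) _
  have hsumS : ∀ (R : Set ℝ), MeasurableSet R → Summable fun n => ∫ t, ‖R.indicator (T n) t‖ := by
    intro R hR
    refine Summable.of_nonneg_of_le (fun n => integral_nonneg fun t => norm_nonneg _)
      (fun n => integral_mono ((hprops n).2.2.1.indicator hR).norm (hprops n).2.2.1.norm (hnormS R n)) hsumI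
  have hindS : ∀ (R : Set ℝ) t, R.indicator σ t = ∑' n, R.indicator (T n) t := by
    intro R t
    by_cases ht : t ∈ R
    · simp only [indicator_of_mem ht, hσdef, liebWuSigmaAtS, hT]
    · simp only [indicator_of_notMem ht, tsum_zero]
  -- inner sum (part 1): `(1_S σ ∗ K)(y) = Σ (1_S Ŵⁿξ ∗ K)(y)`
  have hinner : ∀ y, ∫ t, S.indicator σ t * cauchyDensity (U / 4) (y - t) =
      ∑' n, ∫ t, S.indicator (T n) t * cauchyDensity (U / 4) (y - t) := by
    intro y
    rw [integral_tsum_of_summable_integral_norm (fun n => integrable_mul_sub₂ (hTSi n)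
      (continuous_cauchyDensity hc) hKB y) ?_]
    · refine integral_congr_ae (Eventually.of_forall fun t => ?_)
      beta_reduce
      rw [hindS S t]
      exact tsum_mul_right.symm
    · refine Summable.of_nonneg_of_le (fun n => integral_nonneg fun t => norm_nonneg _) (fun n => ?_)
        ((hsumS S hS).mul_right (1 / (π * (U / 4))))
      rw [← MeasureTheory.integral_mul_const]
      refine integral_mono ((integrable_mul_sub₂ (hTSi n) (continuous_cauchyDensity hc) hKB y).norm)
        ((hTSi n).norm.mul_const _) fun t => ?_
      dsimp only
      rw [norm_mul]
      exact mul_le_mul_of_nonneg_left (by rw [Real.norm_eq_abs]; exact hKB _) (norm_nonneg _)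
  -- outer sum (part 1)
  have hterm : ∀ n, Integrable fun y => A y * (∫ t, S.indicator (T n) t *
      cauchyDensity (U / 4) (y - t)) * sechKernel (U / 4) (x - y) := by
    intro n
    obtain ⟨hGi, _⟩ := integrable_conv_and_integral₂ (hTSi n) (integrable_cauchyDensity hc.le)
    have h1 : Integrable fun y => A y * ∫ t, S.indicator (T n) t * cauchyDensity (U / 4) (y - t) :=
      hGi.bdd_mul hAm (Eventually.of_forall fun y => by rw [Real.norm_eq_abs]; exact hA1 y)
    exact h1.mul_bdd ((continuous_sechKernel hc).comp (continuous_const.sub continuous_id)).aestronglyMeasurable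
      (Eventually.of_forall fun y => by
        rw [Real.norm_eq_abs, abs_of_pos (sechKernel_pos hc _)]; exact sechKernel_le hc _)
  have houter : ∫ y, A y * (∫ t, S.indicator σ t * cauchyDensity (U / 4) (y - t)) *
      sechKernel (U / 4) (x - y) = ∑' n, ∫ y, A y * (∫ t, S.indicator (T n) t *
        cauchyDensity (U / 4) (y - t)) * sechKernel (U / 4) (x - y) := by
    rw [integral_tsum_of_summable_integral_norm hterm ?_]
    · refine integral_congr_ae (Eventually.of_forall fun y => ?_)
      beta_reduce
      rw [hinner y, ← tsum_mul_left, ← tsum_mul_right]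
    · refine Summable.of_nonneg_of_le (fun n => integral_nonneg fun t => norm_nonneg _) (fun n => ?_)
        ((hsumS S hS).mul_right (1 / (2 * (U / 4))))
      obtain ⟨hGi, hGint⟩ := integrable_conv_and_integral₂ (hTSi n) (integrable_cauchyDensity hc.le)
      rw [integral_cauchyDensity hc, mul_one] at hGint
      have hTS0 : ∀ t, 0 ≤ S.indicator (T n) t := fun t => indicator_nonneg (fun s _ => (hprops n).2.1 s) _
      have hG0 : ∀ y, 0 ≤ ∫ t, S.indicator (T n) t * cauchyDensity (U / 4) (y - t) := fun y =>
        integral_nonneg fun t => mul_nonneg (hTS0 t) (cauchyDensity_pos hc _).le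
      have hn : ∫ t, ‖S.indicator (T n) t‖ = ∫ t, S.indicator (T n) t :=
        integral_congr_ae (Eventually.of_forall fun t => Real.norm_of_nonneg (hTS0 t))
      rw [hn, ← hGint, ← MeasureTheory.integral_mul_const]
      refine integral_mono (hterm n).norm (hGi.mul_const _) fun y => ?_
      dsimp only
      rw [norm_mul, norm_mul, Real.norm_eq_abs, Real.norm_eq_abs, Real.norm_eq_abs, abs_of_nonneg (hG0 y),
        abs_of_pos (sechKernel_pos hc _)]
      calc |A y| * (∫ t, S.indicator (T n) t * cauchyDensity (U / 4) (y - t)) * sechKernel (U / 4) (x - y)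
          ≤ 1 * (∫ t, S.indicator (T n) t * cauchyDensity (U / 4) (y - t)) * (1 / (2 * (U / 4))) :=
            mul_le_mul (mul_le_mul_of_nonneg_right (hA1 y) (hG0 y)) (sechKernel_le hc _)
              (sechKernel_pos hc _).le (mul_nonneg zero_le_one (hG0 y))
        _ = _ := by rw [one_mul]
  -- part 2: `u ∗ (1_{Sᶜ} σ) = Σ u ∗ (1_{Sᶜ} Ŵⁿξ)`
  have hpart2 : ∫ t, Sᶜ.indicator σ t * fermiKernel (U / 4) (x - t) =
      ∑' n, ∫ t, Sᶜ.indicator (T n) t * fermiKernel (U / 4) (x - t) := by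
    rw [integral_tsum_of_summable_integral_norm (fun n => integrable_mul_sub₂ (hTSci n)
      (continuous_fermiKernel hc) huB x) ?_]
    · refine integral_congr_ae (Eventually.of_forall fun t => ?_)
      beta_reduce
      rw [hindS Sᶜ t]
      exact tsum_mul_right.symm
    · refine Summable.of_nonneg_of_le (fun n => integral_nonneg fun t => norm_nonneg _) (fun n => ?_)
        ((hsumS Sᶜ hS.compl).mul_right (1 / (2 * π * (U / 4))))
      rw [← MeasureTheory.integral_mul_const]
      refine integral_mono ((integrable_mul_sub₂ (hTSci n) (continuous_fermiKernel hc) huB x).norm)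
        ((hTSci n).norm.mul_const _) fun t => ?_
      dsimp only
      rw [norm_mul]
      exact mul_le_mul_of_nonneg_left (by rw [Real.norm_eq_abs]; exact huB _) (norm_nonneg _)
  -- assemble
  have hsum1 : Summable fun n => ∫ y, A y * (∫ t, S.indicator (T n) t *
      cauchyDensity (U / 4) (y - t)) * sechKernel (U / 4) (x - y) := by
    refine Summable.of_norm_bounded_eventually_nat (g := fun n => ∫ y, ‖A y * (∫ t, S.indicator (T n) t *
      cauchyDensity (U / 4) (y - t)) * sechKernel (U / 4) (x - y)‖) ?_ (Eventually.of_forall fun n =>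
        norm_integral_le_integral_norm _)
    refine Summable.of_nonneg_of_le (fun n => integral_nonneg fun t => norm_nonneg _) (fun n => ?_)
      ((hsumS S hS).mul_right (1 / (2 * (U / 4))))
    obtain ⟨hGi, hGint⟩ := integrable_conv_and_integral₂ (hTSi n) (integrable_cauchyDensity hc.le)
    rw [integral_cauchyDensity hc, mul_one] at hGint
    have hTS0 : ∀ t, 0 ≤ S.indicator (T n) t := fun t => indicator_nonneg (fun s _ => (hprops n).2.1 s) _
    have hG0 : ∀ y, 0 ≤ ∫ t, S.indicator (T n) t * cauchyDensity (U / 4) (y - t) := fun y =>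
      integral_nonneg fun t => mul_nonneg (hTS0 t) (cauchyDensity_pos hc _).le
    have hn : ∫ t, ‖S.indicator (T n) t‖ = ∫ t, S.indicator (T n) t :=
      integral_congr_ae (Eventually.of_forall fun t => Real.norm_of_nonneg (hTS0 t))
    rw [hn, ← hGint, ← MeasureTheory.integral_mul_const]
    refine integral_mono (hterm n).norm (hGi.mul_const _) fun y => ?_
    dsimp only
    rw [norm_mul, norm_mul, Real.norm_eq_abs, Real.norm_eq_abs, Real.norm_eq_abs, abs_of_nonneg (hG0 y),
      abs_of_pos (sechKernel_pos hc _)]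
    calc |A y| * (∫ t, S.indicator (T n) t * cauchyDensity (U / 4) (y - t)) * sechKernel (U / 4) (x - y)
        ≤ 1 * (∫ t, S.indicator (T n) t * cauchyDensity (U / 4) (y - t)) * (1 / (2 * (U / 4))) :=
          mul_le_mul (mul_le_mul_of_nonneg_right (hA1 y) (hG0 y)) (sechKernel_le hc _)
            (sechKernel_pos hc _).le (mul_nonneg zero_le_one (hG0 y))
      _ = _ := by rw [one_mul]
  have hsum2 : Summable fun n => ∫ t, Sᶜ.indicator (T n) t * fermiKernel (U / 4) (x - t) := by
    refine Summable.of_norm_bounded_eventually_nat (g := fun n => ∫ t, ‖Sᶜ.indicator (T n) t *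
      fermiKernel (U / 4) (x - t)‖) ?_ (Eventually.of_forall fun n => norm_integral_le_integral_norm _)
    refine Summable.of_nonneg_of_le (fun n => integral_nonneg fun t => norm_nonneg _) (fun n => ?_)
      ((hsumS Sᶜ hS.compl).mul_right (1 / (2 * π * (U / 4))))
    rw [← MeasureTheory.integral_mul_const]
    refine integral_mono ((integrable_mul_sub₂ (hTSci n) (continuous_fermiKernel hc) huB x).norm)
      ((hTSci n).norm.mul_const _) fun t => ?_
    dsimp only
    rw [norm_mul]
    exact mul_le_mul_of_nonneg_left (by rw [Real.norm_eq_abs]; exact huB _) (norm_nonneg _)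
  calc liebWuWS U Q S σ x = 1 / 2 * (∑' n, ∫ y, A y * (∫ t, S.indicator (T n) t *
        cauchyDensity (U / 4) (y - t)) * sechKernel (U / 4) (x - y)) +
          ∑' n, ∫ t, Sᶜ.indicator (T n) t * fermiKernel (U / 4) (x - t) := by
        rw [liebWuWS, liebWuW, houter, hpart2]
    _ = ∑' n, ((1 / 2 * ∫ y, A y * (∫ t, S.indicator (T n) t *
        cauchyDensity (U / 4) (y - t)) * sechKernel (U / 4) (x - y)) +
          ∫ t, Sᶜ.indicator (T n) t * fermiKernel (U / 4) (x - t)) := by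
        rw [← tsum_mul_left, ← (hsum1.mul_left (1 / 2)).tsum_add hsum2]
    _ = ∑' n, liebWuNeumannTermS U Q S (n + 1) x := by
        refine tsum_congr fun n => ?_
        rfl

/-- **The fixed-point equation (S) for the range `S`: `σ_S = ξ + Ŵσ_S`.** [cite: LiebWuPhysicaA2003, §5, eqs. (S), (series)] -/
theorem liebWuSigmaAtS_eq_xi_add_WS (hU : 0 < U) (hQ : 0 < Q) (hS : MeasurableSet S) (x : ℝ) :
    liebWuSigmaAtS U Q S x = liebWuXi U Q x + liebWuWS U Q S (liebWuSigmaAtS U Q S) x := by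
  rw [liebWuWS_liebWuSigmaAtS hU hQ hS x, liebWuSigmaAtS,
    (summable_liebWuNeumannTermS hU hQ hS x).tsum_eq_zero_add]
  rfl

end Literature.MathematicalPhysics.QuantumLattice

end
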